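import Summits.CriticalPhenomena.SAWScalingLimit.Theorems.SAWDefectDecoherencePolygonParitySqueezeDefs
import Summits.CriticalPhenomena.SAWScalingLimit.Theorems.SAWDefectDecoherenceBoundaryClosureRGateFrameRegular
import Summits.CriticalPhenomena.SAWScalingLimit.Theorems.SAWDefectDecoherenceBoundaryClosureRLocalL1Normaliser
import Summits.CriticalPhenomena.SAWScalingLimit.Theorems.SAWDefectDecoherenceBoundaryClosureRSqueezeSandwich
import Literature.Probability.RandomPlanarGeometry.HexParafermionSpinShift
import HarnessLib

/-!
# Gate trace from gate data, I: lattice bookkeeping on small FULL gate balls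
(crux `BoundaryClosureR`, stmt-CriticalPhenomena-14004, line `polygon-parity-squeeze`, registered
stub `stub_gateTrace`, mechanism (C); registered sub-goal `gateTrace_l1Bound_gateBall`)

Mechanism (C) takes weak-* limits of the normalised bulk functionals `N_δ` on a FULL small ball
around a gate point (straddling the flat gate), so it needs the eventual `L¹` bound
`δ² Σ_{δ·mid z ∈ K} ‖F_δ(z)‖ ≤ C ‖F_δ(b_δ)‖` for compacts `K` of such a ball, and the vanishing of
`N_δ` on tests supported strictly below the gate.  Both are lattice bookkeeping on the exact
half-lattice of the normaliser's pin:

* `eventually_im_center_gt` — every vertex of `Λ δ` on a mid-edge with scaled midpoint in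
  `B(pt 1, ρ/2)` has its scaled centre strictly ABOVE the gate line and within `δ` of the midpoint;
* `eventually_NF_eq_zero_of_below` — hence `N_δ(ψ) = 0` eventually for `ψ` supported below the gate;
* `l1Bound_gateBall` (registry form `gateTrace_l1Bound_gateBall`) — the `L¹` bound on compacts of
  the full ball `B(pt 1, ρ/8)`: on or above the gate line the model input `GateL1Root` applies; below
  it only gate darts occur (`‖F_{5/8}‖ ≤ Z`), whose masses the gate PROFILE LAW (`GateProfileAt`,
  tested against a bump `= 1` on `K`) bounds by `O(Z(b_δ)/δ)`;
* `exists_gateExtension` — the frame `L = log Φ'` extends continuously to `Ω ∪ gate` off the root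
  (`Identification.gateTrace_frameRegular` + `continuousOn_extendFrom`).
-/

noncomputable section

open scoped BigOperators Topology ContDiff
open Filter Set Metric MeasureTheory Complex
open Literature.Probability.LatticeModels Literature.Probability.RandomPlanarGeometry
open Literature.Probability.RandomPlanarGeometry.SAW
open Summit.CriticalPhenomena.SAWScalingLimit.Theses.SAWDefectDecoherence
open Summit.CriticalPhenomena.SAWScalingLimit.Theorems.PickHalfPlane

namespace Summit.CriticalPhenomena.SAWScalingLimit.Theorems.PolygonParitySqueeze

/-! ### 1. Lattice geometry near the gate: endpoints of mid-edges lie above the gate line -/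

/-- An endpoint of a hexagon edge is within half an edge length (`≤ 1`) of its midpoint, after
scaling by `δ ≥ 0`: `dist (δ c_v) (δ mid z) ≤ δ`. [folklore] -/
theorem dist_center_midpoint_le {z : Sym2 HexVertex} (hz : z ∈ hexGraph.edgeSet) {v : HexVertex}
    (hv : v ∈ z) {δ : ℝ} (hδ : 0 ≤ δ) :
    dist ((δ : ℂ) * hexCenter v) ((δ : ℂ) * hexMidpoint z) ≤ δ := by
  obtain ⟨w, hw⟩ : ∃ w, z = s(v, w) := ⟨Sym2.Mem.other hv, (Sym2.other_spec hv).symm⟩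
  subst hw
  have hadj : hexGraph.Adj v w := (SimpleGraph.mem_edgeSet hexGraph).1 hz
  have hnorm : ‖hexCenter v - hexCenter w‖ = (Real.sqrt 3)⁻¹ := norm_hexCenter_sub_of_adj hadj.symm
  have h3 : (Real.sqrt 3)⁻¹ ≤ 1 := by
    rw [inv_le_one_iff₀]
    exact Or.inr (Real.one_le_sqrt.2 (by norm_num))
  rw [dist_eq_norm, ← mul_sub, norm_mul, Complex.norm_real, Real.norm_of_nonneg hδ, hexMidpoint_mk,
    show hexCenter v - (hexCenter v + hexCenter w) / 2 = (hexCenter v - hexCenter w) / 2 by ring,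
    norm_div, Complex.norm_two, hnorm]
  calc δ * ((Real.sqrt 3)⁻¹ / 2) ≤ δ * 1 := by
        refine mul_le_mul_of_nonneg_left ?_ hδ; linarith [inv_nonneg.2 (Real.sqrt_nonneg 3)]
    _ = δ := mul_one δ

/-- **Endpoints lie above the gate.** For an admissible family, eventually in `δ`: every vertex of
`Λ δ` on a mid-edge whose scaled midpoint lies in `B(pt 1, ρ/2)` has its scaled centre STRICTLY
ABOVE the gate line (it lies in the carrier, which is the upper half-plane inside `B(pt 1, ρ)`), and
within `δ` of the scaled midpoint. [folklore] -/
theorem eventually_im_center_gt {D : DobrushinDomain} {ρ : ℝ} {Λ : ℝ → Finset HexVertex}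
    {m : ℝ → ℤ} {b : ℝ → Sym2 HexVertex} (hAF : AdmissibleFamily D ρ Λ m b) :
    ∀ᶠ δ : ℝ in 𝓝[>] 0, ∀ z ∈ hexDomainMidEdges (Λ δ),
      (δ : ℂ) * hexMidpoint z ∈ ball (D.pt 1) (ρ / 2) → ∀ v ∈ z, v ∈ Λ δ →
        (D.pt 1).im < ((δ : ℂ) * hexCenter v).im ∧
          dist ((δ : ℂ) * hexCenter v) ((δ : ℂ) * hexMidpoint z) ≤ δ := by
  obtain ⟨hρ, hflat, hadm, -, -⟩ := hAF
  have hsmall : ∀ᶠ δ : ℝ in 𝓝[>] 0, δ < ρ / 2 :=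
    (eventually_lt_nhds (by positivity : (0 : ℝ) < ρ / 2)).filter_mono nhdsWithin_le_nhds
  filter_upwards [hadm, hsmall, self_mem_nhdsWithin] with δ hδ hδρ hδ0
  intro z hz hzb v hv hvΛ
  have hdist : dist ((δ : ℂ) * hexCenter v) ((δ : ℂ) * hexMidpoint z) ≤ δ :=
    dist_center_midpoint_le hz.1 hv (le_of_lt hδ0)
  refine ⟨?_, hdist⟩
  have hball : (δ : ℂ) * hexCenter v ∈ ball (D.pt 1) ρ := by
    rw [mem_ball]
    calc dist ((δ : ℂ) * hexCenter v) (D.pt 1)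
        ≤ dist ((δ : ℂ) * hexCenter v) ((δ : ℂ) * hexMidpoint z) +
            dist ((δ : ℂ) * hexMidpoint z) (D.pt 1) := dist_triangle _ _ _
      _ < δ + ρ / 2 := add_lt_add_of_le_of_lt hdist (mem_ball.1 hzb)
      _ < ρ := by linarith
  have hmem : (δ : ℂ) * hexCenter v ∈ D.carrier ∩ ball (D.pt 1) ρ := ⟨hδ.2.2.2.1 v hvΛ, hball⟩
  rw [hflat] at hmem
  exact hmem.1

/-- **No lattice below the gate.** For an admissible family and a test function `ψ` compactly
supported in the open LOWER half of the gate ball `B(pt 1, ρ/2)`, the normalised functional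
`N_δ(ψ)` vanishes eventually: every mid-edge of `Λ δ` has an endpoint in `Λ δ`, whose scaled centre
lies above the gate and within `δ` of the scaled midpoint, so no scaled midpoint enters the support.
[folklore] -/
theorem eventually_NF_eq_zero_of_below {D : DobrushinDomain} {ρ : ℝ} {Λ : ℝ → Finset HexVertex}
    {m : ℝ → ℤ} {b : ℝ → Sym2 HexVertex} (hAF : AdmissibleFamily D ρ Λ m b)
    (a : ℝ → Sym2 HexVertex) {ψ : ℂ → ℂ} (hψc : HasCompactSupport ψ)
    (hψs : tsupport ψ ⊆ {z : ℂ | z.im < (D.pt 1).im} ∩ ball (D.pt 1) (ρ / 2)) :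
    ∀ᶠ δ : ℝ in 𝓝[>] 0, NF Λ a b δ ψ = 0 := by
  -- a positive gap between the support and the gate line
  obtain ⟨d, hd, hgap⟩ : ∃ d : ℝ, 0 < d ∧ ∀ p ∈ tsupport ψ, p.im ≤ (D.pt 1).im - d := by
    by_cases hne : (tsupport ψ).Nonempty
    · obtain ⟨p₀, hp₀, hmax⟩ := hψc.isCompact.exists_isMaxOn hne Complex.continuous_im.continuousOn
      refine ⟨(D.pt 1).im - p₀.im, sub_pos.2 (hψs hp₀).1, fun p hp => ?_⟩
      have := hmax hp
      simp only [mem_setOf_eq] at this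
      linarith
    · exact ⟨1, one_pos, fun p hp => absurd ⟨p, hp⟩ hne⟩
  have hsmall : ∀ᶠ δ : ℝ in 𝓝[>] 0, δ < d :=
    (eventually_lt_nhds hd).filter_mono nhdsWithin_le_nhds
  filter_upwards [eventually_im_center_gt hAF, hsmall] with δ hδ hδd
  -- every summand vanishes
  have hzero : ∀ z ∈ hexDomainMidEdges (Λ δ),
      ψ ((δ : ℂ) * hexMidpoint z) *
        hexParafermionicObservable (Λ δ) (a δ) hexCriticalFugacity (5 / 8) z = 0 := by
    intro z hz
    by_cases hψz : (δ : ℂ) * hexMidpoint z ∈ tsupport ψ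
    · exfalso
      obtain ⟨v, hv, hvΛ⟩ := hz.2
      obtain ⟨him, hdist⟩ := hδ z hz ((hψs hψz).2) v hv hvΛ
      have h1 := hgap _ hψz
      have h2 : |((δ : ℂ) * hexCenter v - (δ : ℂ) * hexMidpoint z).im| ≤ δ :=
        (Complex.abs_im_le_norm _).trans (by rwa [← dist_eq_norm])
      rw [Complex.sub_im] at h2
      have h3 := (abs_le.1 h2).2
      linarith
    · rw [image_eq_zero_of_notMem_tsupport hψz, zero_mul]
  rw [NF, finsum_mem_of_eqOn_zero hzero, mul_zero, zero_div]

/-! ### 2. Finite sums of non-negative terms over windows -/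

/-- Monotonicity of finite sums of non-negative terms under enlarging the window and the summand.
[folklore] -/
theorem finsum_mem_le_finsum_mem_of_subset {α : Type*} {S T : Set α} (hT : T.Finite) (hS : S ⊆ T)
    {f g : α → ℝ} (hfg : ∀ x ∈ S, f x ≤ g x) (hg : ∀ x, 0 ≤ g x) :
    ∑ᶠ x ∈ S, f x ≤ ∑ᶠ x ∈ T, g x := by
  classical
  have hSf : S.Finite := hT.subset hS
  rw [finsum_mem_eq_finite_toFinset_sum f hSf, finsum_mem_eq_finite_toFinset_sum g hT]
  calc ∑ x ∈ hSf.toFinset, f x ≤ ∑ x ∈ hSf.toFinset, g x :=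
        Finset.sum_le_sum fun x hx => hfg x ((Set.Finite.mem_toFinset _).1 hx)
    _ ≤ ∑ x ∈ hT.toFinset, g x :=
        Finset.sum_le_sum_of_subset_of_nonneg
          (fun x hx => (Set.Finite.mem_toFinset _).2 (hS ((Set.Finite.mem_toFinset _).1 hx)))
          fun x _ _ => hg x

/-- A finite sum of non-negative terms over a window contained in the union of two finite windows
is at most the sum of the two sums. [folklore] -/
theorem finsum_mem_le_add_of_subset_union {α : Type*} {S T U : Set α} (hT : T.Finite)
    (hU : U.Finite) (hS : S ⊆ T ∪ U) {f : α → ℝ} (hf : ∀ x, 0 ≤ f x) :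
    ∑ᶠ x ∈ S, f x ≤ (∑ᶠ x ∈ T, f x) + ∑ᶠ x ∈ U, f x := by
  classical
  have hSf : S.Finite := (hT.union hU).subset hS
  rw [finsum_mem_eq_finite_toFinset_sum f hSf, finsum_mem_eq_finite_toFinset_sum f hT,
    finsum_mem_eq_finite_toFinset_sum f hU]
  calc ∑ x ∈ hSf.toFinset, f x ≤ ∑ x ∈ hT.toFinset ∪ hU.toFinset, f x := by
        refine Finset.sum_le_sum_of_subset_of_nonneg (fun x hx => ?_) fun x _ _ => hf x
        rw [Finset.mem_union, Set.Finite.mem_toFinset, Set.Finite.mem_toFinset]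
        exact hS ((Set.Finite.mem_toFinset _).1 hx)
    _ ≤ ∑ x ∈ hT.toFinset, f x + ∑ x ∈ hU.toFinset, f x := by
        have h := Finset.sum_union_inter (s₁ := hT.toFinset) (s₂ := hU.toFinset) (f := f)
        have h0 : 0 ≤ ∑ x ∈ hT.toFinset ∩ hU.toFinset, f x := Finset.sum_nonneg fun x _ => hf x
        linarith

/-! ### 3. The conformal frame extends continuously to the open gate -/

/-- **Continuous extension of the frame to the gate.** If the gate ball `B(pt 1, ρ)` stays off the
root (`ρ ≤ |pt 0 − pt 1|`), the continuous branch `L` of `log Φ'` extends to a function continuous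
on `Ω ∪ gate` (limits at gate points: `Identification.gateTrace_frameRegular`; extension by
continuity: `continuousOn_extendFrom`). [cite: PommerenkeBBCM1992, Thm. 2.6] -/
theorem exists_gateExtension (D : DobrushinDomain) {ρ : ℝ}
    (hflat : D.carrier ∩ ball (D.pt 1) ρ = {z : ℂ | (D.pt 1).im < z.im} ∩ ball (D.pt 1) ρ)
    (hρd : ρ ≤ dist (D.pt 0) (D.pt 1))
    (Φ : ConformalEquiv D.carrier UpperHalfPlane.upperHalfPlaneSet) (L : ℂ → ℂ)
    (hΦ : Tendsto (fun z => ‖Φ z‖) (𝓝[D.carrier] (D.pt 0)) atTop)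
    (hL : ContinuousOn L D.carrier) (hexpL : ∀ z ∈ D.carrier, Complex.exp (L z) = deriv Φ z) :
    ∃ Lbar : ℂ → ℂ, ContinuousOn Lbar (D.carrier ∪ gateSeg D ρ) ∧ EqOn Lbar L D.carrier := by
  refine ⟨extendFrom D.carrier L, continuousOn_extendFrom ?_ ?_, fun z hz =>
    extendFrom_eq (subset_closure hz) (hL z hz)⟩
  · rintro z (hz | ⟨hzim, hzb⟩)
    · exact subset_closure hz
    · exact Identification.mem_closure_of_flat hflat hzb hzim
  · rintro z (hz | ⟨hzim, hzb⟩)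
    · exact ⟨L z, hL z hz⟩
    · refine Identification.gateTrace_frameRegular D ρ hflat Φ L hΦ hL hexpL z hzim hzb fun h => ?_
      have : dist (D.pt 0) (D.pt 1) < ρ := by rw [← h]; exact mem_ball.1 hzb
      linarith

/-! ### 4. The `L¹` bound on a FULL small gate ball (above: `GateL1Root`; below: the profile law) -/

/-- **`L¹` bound on full small gate balls.** For an admissible pinned family with disjoint pinned
balls, the gate profile law on `B(pt 1, ρ/4)` (evaluated at one frame) and the `L¹` law on compacts
of `Ω ∪ gate` off the root give the eventual bound
`δ² Σ_{δ·mid z ∈ K} ‖F_δ(z)‖ ≤ C ‖F_δ(b_δ)‖` for every compact `K` of the FULL ball `B(pt 1, ρ/8)`: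
mid-edges with scaled midpoint on or above the gate line are covered by the `L¹` law; those below
it are gate darts (their endpoint in `Λ δ` lies above the line), whose `σ = 5/8` moduli are at most
their arrival masses, controlled by the profile law tested against a bump `= 1` on `K`.
[cite: DuminilCopinSmirnov2012, Conjecture 2 (normalised observable)] -/
theorem l1Bound_gateBall {D : DobrushinDomain} {ρ : ℝ} {Λ : ℝ → Finset HexVertex} {m : ℝ → ℤ}
    {b : ℝ → Sym2 HexVertex} (hAF : AdmissibleFamily D ρ Λ m b) {a : ℝ → Sym2 HexVertex} {r₀ : ℝ}
    {m₀ : ℝ → ℤ} (hPR : PinnedFlatRoot D Λ b (D.pt 0) a r₀ m₀) (hρd : 2 * ρ < dist (D.pt 0) (D.pt 1))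
    (hGP : GateProfileAt D ρ (ρ / 4) Λ a b)
    (hL1 : ∀ K : Set ℂ, IsCompact K → K ⊆ D.carrier ∪ gateSeg D ρ → D.pt 0 ∉ K → L1BoundOn Λ a b K)
    (Φ : ConformalEquiv D.carrier UpperHalfPlane.upperHalfPlaneSet) (L : ℂ → ℂ) (Lb : ℂ)
    (hfr : ConformalFrame D Φ L Lb) (Lbar : ℂ → ℂ) (hLbar : ContinuousOn Lbar (D.carrier ∪ gateSeg D ρ))
    (hLbarL : EqOn Lbar L D.carrier) :
    ∀ K : Set ℂ, IsCompact K → K ⊆ ball (D.pt 1) (ρ / 8) → ∃ C : ℝ, ∀ᶠ δ : ℝ in 𝓝[>] 0,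
      δ ^ 2 * (∑ᶠ z ∈ {z : Sym2 HexVertex | z ∈ hexDomainMidEdges (Λ δ) ∧
          (δ : ℂ) * hexMidpoint z ∈ K},
        ‖hexParafermionicObservable (Λ δ) (a δ) hexCriticalFugacity (5 / 8) z‖) ≤
      C * ‖hexParafermionicObservable (Λ δ) (a δ) hexCriticalFugacity (5 / 8) (b δ)‖ := by
  intro K hK hKb
  have hρ : 0 < ρ := hAF.1
  have hflat := hAF.2.1
  have hadm := hAF.2.2.1
  ---------------------------------------------------------------- the part on or above the gate line
  set Kp : Set ℂ := K ∩ {z : ℂ | (D.pt 1).im ≤ z.im} with hKpdef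
  have hKp : IsCompact Kp := hK.inter_right (isClosed_le continuous_const Complex.continuous_im)
  have hKpsub : Kp ⊆ D.carrier ∪ gateSeg D ρ := by
    rintro z ⟨hzK, hz⟩
    have hzρ : z ∈ ball (D.pt 1) ρ := ball_subset_ball (by linarith) (hKb hzK)
    rcases (show (D.pt 1).im ≤ z.im from hz).lt_or_eq with hlt | heq
    · left
      have : z ∈ {z : ℂ | (D.pt 1).im < z.im} ∩ ball (D.pt 1) ρ := ⟨hlt, hzρ⟩
      rw [← hflat] at this
      exact this.1
    · right
      exact ⟨heq.symm, hzρ⟩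
  have hKp0 : D.pt 0 ∉ Kp := fun h => by
    have h1 : dist (D.pt 0) (D.pt 1) < ρ / 8 := mem_ball.1 (hKb h.1)
    linarith
  obtain ⟨C₁, hC₁⟩ := hL1 Kp hKp hKpsub hKp0
  ---------------------------------------------------------------- the profile law against a bump
  let β : ContDiffBump (D.pt 1) := ⟨ρ / 8, ρ / 6, by positivity, by linarith⟩
  set g₀ : ℂ → ℂ := fun z => ((β z : ℝ) : ℂ) with hg₀def
  have hg₀c : Continuous g₀ := continuous_ofReal.comp β.continuous
  have hg₀s : HasCompactSupport g₀ := β.hasCompactSupport.comp_left Complex.ofReal_zero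
  have hg₀t : tsupport g₀ ⊆ ball (D.pt 1) (ρ / 4) := by
    refine (tsupport_comp_subset Complex.ofReal_zero _).trans ?_
    rw [β.tsupport_eq]
    exact closedBall_subset_ball (by show ρ / 6 < ρ / 4; linarith)
  obtain ⟨ℓ, hT⟩ : ∃ ℓ : ℂ, Tendsto (fun δ : ℝ => (δ : ℂ) *
      ∑ᶠ e ∈ {e : Sym2 HexVertex | e ∈ hexDomainBoundary (Λ δ) ∧
          (δ : ℂ) * hexMidpoint e ∈ ball (D.pt 1) (ρ / 4)},
        g₀ ((δ : ℂ) * hexMidpoint e) *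
          (hexParafermionicObservable (Λ δ) (a δ) hexCriticalFugacity 0 e /
            hexParafermionicObservable (Λ δ) (a δ) hexCriticalFugacity 0 (b δ))) (𝓝[>] 0) (𝓝 ℓ) :=
    ⟨_, hGP Φ L Lb hfr Lbar hLbar hLbarL g₀ hg₀c hg₀s hg₀t⟩
  have hbdd := (hT.norm).eventually (gt_mem_nhds (lt_add_one ‖ℓ‖))
  ---------------------------------------------------------------- eventual lattice facts
  have hnorm := LocalL1.eventually_normaliser_ne_zero (l := 𝓝[>] 0)
    (hadm.mono fun δ h => ⟨h.1, h.2.1⟩) (hPR.2.2.1.mono fun δ h => ⟨h.1, h.2.1⟩)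
    hexCriticalFugacity_pos_lt_one.1 (5 / 8)
  have hone : ∀ᶠ δ : ℝ in 𝓝[>] 0, δ < 1 :=
    (eventually_lt_nhds one_pos).filter_mono nhdsWithin_le_nhds
  refine ⟨C₁ + (‖ℓ‖ + 1), ?_⟩
  filter_upwards [hC₁, hbdd, hnorm, hone, self_mem_nhdsWithin, eventually_im_center_gt hAF,
    hPR.2.2.1] with δ hδC₁ hδbdd hδnorm hδ1 hδ0 hδabove hδroot
  have hδpos : (0 : ℝ) < δ := hδ0
  set F : Sym2 HexVertex → ℂ := hexParafermionicObservable (Λ δ) (a δ) hexCriticalFugacity (5 / 8)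
    with hFdef
  set Z : Sym2 HexVertex → ℂ := hexParafermionicObservable (Λ δ) (a δ) hexCriticalFugacity 0
    with hZdef
  -- index windows
  set A : Set (Sym2 HexVertex) := {z | z ∈ hexDomainMidEdges (Λ δ) ∧ (δ : ℂ) * hexMidpoint z ∈ K}
  set B : Set (Sym2 HexVertex) := {z | z ∈ hexDomainMidEdges (Λ δ) ∧ (δ : ℂ) * hexMidpoint z ∈ Kp}
  set Cw : Set (Sym2 HexVertex) := {e | e ∈ hexDomainBoundary (Λ δ) ∧ (δ : ℂ) * hexMidpoint e ∈ K}
  set W : Set (Sym2 HexVertex) :=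
    {e | e ∈ hexDomainBoundary (Λ δ) ∧ (δ : ℂ) * hexMidpoint e ∈ ball (D.pt 1) (ρ / 4)}
  have hBf : B.Finite := GateMass.finite_midEdgeWindow (Λ δ) _
  have hCf : Cw.Finite := GateMass.finite_boundaryWindow (Λ δ) _
  have hWf : W.Finite := GateMass.finite_boundaryWindow (Λ δ) _
  -- every mid-edge of `A` below the gate line is a gate dart
  have hAsub : A ⊆ B ∪ Cw := by
    rintro z ⟨hz, hzK⟩
    by_cases hup : (D.pt 1).im ≤ ((δ : ℂ) * hexMidpoint z).im
    · exact Or.inl ⟨hz, hzK, hup⟩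
    · refine Or.inr ⟨?_, hzK⟩
      have hzb : (δ : ℂ) * hexMidpoint z ∈ ball (D.pt 1) (ρ / 2) :=
        ball_subset_ball (by linarith) (hKb hzK)
      obtain ⟨v, hv, hvΛ⟩ := hz.2
      obtain ⟨w, hw⟩ : ∃ w, z = s(v, w) := ⟨Sym2.Mem.other hv, (Sym2.other_spec hv).symm⟩
      have hwz : w ∈ z := by rw [hw]; exact Sym2.mem_mk_right v w
      have hvim := (hδabove z hz hzb v hv hvΛ).1
      have hwΛ : w ∉ Λ δ := fun hwΛ => by
        have hwim := (hδabove z hz hzb w hwz hwΛ).1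
        apply hup
        have e1 : (δ : ℂ) * hexMidpoint z = ((δ : ℂ) * hexCenter v + (δ : ℂ) * hexCenter w) / 2 := by
          rw [hw, hexMidpoint_mk]; ring
        rw [e1, Complex.div_ofNat_im, Complex.add_im]
        linarith
      rw [hw, Sym2.eq_swap]
      exact ⟨by rw [Sym2.eq_swap, ← hw]; exact hz.1, w, v, rfl, hvΛ, hwΛ⟩
  ---------------------------------------------------------------- the estimate
  have hCW : Cw ⊆ W := fun e he => ⟨he.1, ball_subset_ball (by linarith) (hKb he.2)⟩
  -- (1) split the window
  have h1 : ∑ᶠ z ∈ A, ‖F z‖ ≤ (∑ᶠ z ∈ B, ‖F z‖) + ∑ᶠ z ∈ Cw, ‖F z‖ :=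
    finsum_mem_le_add_of_subset_union hBf hCf hAsub fun z => norm_nonneg _
  -- (2) darts: `‖F_{5/8}‖ ≤ Z`, and the bump is `1` on `K`
  set R : ℝ := ∑ᶠ e ∈ W, β ((δ : ℂ) * hexMidpoint e) * ‖Z e‖ with hRdef
  have h2 : ∑ᶠ z ∈ Cw, ‖F z‖ ≤ R := by
    refine finsum_mem_le_finsum_mem_of_subset hWf hCW (fun e he => ?_)
      fun e => mul_nonneg (β.nonneg) (norm_nonneg _)
    have hβ1 : β ((δ : ℂ) * hexMidpoint e) = 1 :=
      β.one_of_mem_closedBall (ball_subset_closedBall (hKb he.2))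
    rw [hβ1, one_mul]
    exact GateMass.norm_obs_le_norm_obs_zero (Λ δ) (a δ) (5 / 8) e
  -- (3) the tested profile value is `δ R / Z(b)`
  have hZb : 0 < ‖Z (b δ)‖ := by rw [hZdef, ← hδnorm.2]; exact norm_pos_iff.2 hδnorm.1
  have hval : ‖(δ : ℂ) * ∑ᶠ e ∈ W, g₀ ((δ : ℂ) * hexMidpoint e) * (Z e / Z (b δ))‖ =
      δ * R / ‖Z (b δ)‖ := by
    have hcongr : ∑ᶠ e ∈ W, g₀ ((δ : ℂ) * hexMidpoint e) * (Z e / Z (b δ)) =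
        ∑ᶠ e ∈ W, (((β ((δ : ℂ) * hexMidpoint e) * ‖Z e‖ / ‖Z (b δ)‖ : ℝ)) : ℂ) := by
      have hZe : ∀ e, Z e = ((‖Z e‖ : ℝ) : ℂ) := fun e => obs_zero_eq_ofReal_norm _ _ _
      refine finsum_mem_congr rfl fun e _ => ?_
      conv_lhs => rw [hg₀def, hZe e, hZe (b δ)]
      push_cast
      ring
    have hsum : ∑ᶠ e ∈ W, (((β ((δ : ℂ) * hexMidpoint e) * ‖Z e‖ / ‖Z (b δ)‖ : ℝ)) : ℂ) =
        ((R / ‖Z (b δ)‖ : ℝ) : ℂ) := by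
      rw [finsum_mem_eq_finite_toFinset_sum _ hWf, hRdef, finsum_mem_eq_finite_toFinset_sum _ hWf,
        Finset.sum_div, Complex.ofReal_sum]
    have hRnn : 0 ≤ R := finsum_nonneg fun e => finsum_nonneg fun _ =>
      mul_nonneg (β.nonneg) (norm_nonneg _)
    rw [hcongr, hsum, ← Complex.ofReal_mul, Complex.norm_real, Real.norm_of_nonneg
      (mul_nonneg hδpos.le (div_nonneg hRnn hZb.le)), mul_div_assoc]
  have h3 : δ * R ≤ ‖Z (b δ)‖ * (‖ℓ‖ + 1) := by
    have hlt : ‖(δ : ℂ) * ∑ᶠ e ∈ W, g₀ ((δ : ℂ) * hexMidpoint e) * (Z e / Z (b δ))‖ < ‖ℓ‖ + 1 :=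
      hδbdd
    rw [hval, div_lt_iff₀ hZb] at hlt
    linarith
  -- (4) assemble
  have hBnn : 0 ≤ ∑ᶠ z ∈ B, ‖F z‖ := finsum_nonneg fun z => finsum_nonneg fun _ => norm_nonneg _
  have hCnn : 0 ≤ ∑ᶠ z ∈ Cw, ‖F z‖ := finsum_nonneg fun z => finsum_nonneg fun _ => norm_nonneg _
  have hFb : ‖Z (b δ)‖ = ‖F (b δ)‖ := by rw [hZdef, hFdef, hδnorm.2]
  have hℓ : 0 ≤ ‖ℓ‖ + 1 := by positivity
  calc δ ^ 2 * ∑ᶠ z ∈ A, ‖F z‖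
      ≤ δ ^ 2 * ((∑ᶠ z ∈ B, ‖F z‖) + ∑ᶠ z ∈ Cw, ‖F z‖) :=
        mul_le_mul_of_nonneg_left h1 (by positivity)
    _ = δ ^ 2 * (∑ᶠ z ∈ B, ‖F z‖) + δ * (δ * ∑ᶠ z ∈ Cw, ‖F z‖) := by ring
    _ ≤ C₁ * ‖F (b δ)‖ + δ * (‖Z (b δ)‖ * (‖ℓ‖ + 1)) := by
        refine add_le_add hδC₁ (mul_le_mul_of_nonneg_left ?_ hδpos.le)
        exact (mul_le_mul_of_nonneg_left h2 hδpos.le).trans h3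
    _ ≤ C₁ * ‖F (b δ)‖ + 1 * (‖Z (b δ)‖ * (‖ℓ‖ + 1)) := by
        refine add_le_add le_rfl (mul_le_mul_of_nonneg_right hδ1.le ?_)
        exact mul_nonneg (norm_nonneg _) hℓ
    _ = (C₁ + (‖ℓ‖ + 1)) * ‖F (b δ)‖ := by rw [hFb]; ring

/-- **Registered sub-goal `gateTrace_l1Bound_gateBall`** (crux item stmt-CriticalPhenomena-14004, line
`polygon-parity-squeeze`, stub `stub_gateTrace`, mechanism (C)): registry form (one `∀`-term) of
`l1Bound_gateBall`. [folklore] -/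
theorem gateTrace_l1Bound_gateBall : ∀ (D : DobrushinDomain) (ρ : ℝ) (Λ : ℝ → Finset HexVertex) (m : ℝ → ℤ) (b : ℝ → Sym2 HexVertex), AdmissibleFamily D ρ Λ m b → ∀ (a : ℝ → Sym2 HexVertex) (r₀ : ℝ) (m₀ : ℝ → ℤ), PinnedFlatRoot D Λ b (D.pt 0) a r₀ m₀ → 2 * ρ < dist (D.pt 0) (D.pt 1) → GateProfileAt D ρ (ρ / 4) Λ a b → (∀ K : Set ℂ, IsCompact K → K ⊆ D.carrier ∪ gateSeg D ρ → D.pt 0 ∉ K → L1BoundOn Λ a b K) → ∀ (Φ : ConformalEquiv D.carrier UpperHalfPlane.upperHalfPlaneSet) (L : ℂ → ℂ) (Lb : ℂ), ConformalFrame D Φ L Lb → ∀ (Lbar : ℂ → ℂ), ContinuousOn Lbar (D.carrier ∪ gateSeg D ρ) → Set.EqOn Lbar L D.carrier → ∀ K : Set ℂ, IsCompact K → K ⊆ Metric.ball (D.pt 1) (ρ / 8) → ∃ C : ℝ, ∀ᶠ δ : ℝ in 𝓝[>] 0, δ ^ 2 * (∑ᶠ z ∈ {z : Sym2 HexVertex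 | z ∈ hexDomainMidEdges (Λ δ) ∧ (δ : ℂ) * hexMidpoint z ∈ K}, ‖hexParafermionicObservable (Λ δ) (a δ) hexCriticalFugacity (5 / 8) z‖) ≤ C * ‖hexParafermionicObservable (Λ δ) (a δ) hexCriticalFugacity (5 / 8) (b δ)‖ :=
  fun _ _ _ _ _ hAF _ _ _ hPR hρd hGP hL1 Φ L Lb hfr Lbar hLbar hLbarL =>
    l1Bound_gateBall hAF hPR hρd hGP hL1 Φ L Lb hfr Lbar hLbar hLbarL

end Summit.CriticalPhenomena.SAWScalingLimit.Theorems.PolygonParitySqueeze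

end
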